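import Summits.CriticalPhenomena.PercolationContinuityZ3.Theorems.PercNearOneGluingAdditiveGluingKnThm2Refined
import Summits.CriticalPhenomena.PercolationContinuityZ3.Theorems.PercNearOneGluingNoHeavyLowerTailWorstPairExchange
import HarnessLib

/-!
# `NoHeavyLowerTail` (stmt-CriticalPhenomena-4575) — k-UNIFORM event gluing from the REFINED Kozma–Nitzan residual
# row (every number of relays), and the crux from it

Support file (prover `prim-ineq-prove-3`, new-inequality factory PROOF seat #3; `--supports stmt-CriticalPhenomena-4575`).
No definitions, no named facts, no sorries.

Setting: `μ = prodBernoulli w` on `Fin n`, observer `o`, sink `b`, a finite relay set `A` with `o ∉ A`, a designated relay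
`a ∈ A` (the factory takes the WORST one, `μ(a ↮ b)` maximal).  For a nonempty `O ⊆ A ∖ {a}` write
`N'_O := {O ∪ {o} ↮ A ∖ O}` (the REFINED separation event of Kozma–Nitzan's Theorem-2 exchange, source set `O ∪ {o}`,
tree `knThm2_refined`), `U_O := {o ↔ some s ∈ O}`, `B_T := {b ↔ every s ∈ T}`.  The k-relay bookkeeping
(`EventGluingRefinedK.pos_split`, `neg_split`) is the exact identity

  `μ(o↔A, o↔b) − μ(o↔A, a↔b) = Σ_{∅ ≠ O ⊆ A∖a} [ μ(N'_O ∩ U_O ∩ B_O) − μ(N'_O ∩ U_O ∩ B_{A∖O}) ]`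

(`O` = the trace `C_b ∩ A` on the positive side, `A ∖ (C_b ∩ A)` on the negative side), and BHK 2006 Thms 1.3/1.4 for the
clusters of the SETS `O ∪ {o}` and `A ∖ O` (landed `stub_bhkSets`, `knRef_bhkOne/Two`) bound each summand below by
`φ'_O · (m'_O − m'_{A∖O})`, `φ'_O = μ(N'_O ∩ U_O)/μ(N'_O)`, `m'_T = μ(N'_O ∩ B_T)` (`EventGluingRefinedK.term_bound`).  Hence:

* `EventGluingRefinedK.eg_of_refinedResidual_at` — if the REFINED RESIDUAL ROW
  `REF_k :  0 ≤ μ(o ↮ A, a ↮ b) + Σ_{∅ ≠ O ⊆ A∖a} φ'_O · (m'_O − m'_{A∖O})`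
  holds on the graph, then event gluing holds at `a`: `μ({o ↔ A} ∖ {o ↔ b}) ≤ μ(a ↮ b)` (any `|A|`; for `|A| = 3` this is
  prim-ineq-prove-4's `eg3_of_refinedResidual` (file `…EG3Residual`), in conditional form);
* `eventGluing_of_refinedResidual` — `REF_k` at the worst relay for every finite weighted graph and every `k` ⇒ EVENT GLUING
  `μ({o ↮ b} ∩ {o ↔ A}) ≤ max_a μ(a ↮ b)` for all relay sets; hence `additiveGluing_of_refinedResidual` (stmt-4576) and
  `noHeavyLowerTail_of_refinedResidual` (stmt-4575) by the landed glue (`additiveGluing_of_eventGluing`,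
  `noHeavyLowerTail_of_eventGluing`).
So the k-uniform conjecture `REF_k` (census: 0 violations for k = 2..6 incl. adversarial climbs and the glued-pair tie family that
refutes the UNREFINED row `(KNS)_k` at k = 3 (tree `not_knResidualRow`) and k = 4; for k = 2 it is KN's Lemma 3(ii)) is a typed sufficient
condition for the crux.
-/

namespace Summit.CriticalPhenomena.PercolationContinuityZ3.Theorems

open MeasureTheory Set Literature.Probability.LatticeModels Literature.Probability.Percolation

noncomputable section
open Classical

variable {n : ℕ}

namespace EventGluingRefinedK

/-- Positive side of the k-relay split: on `{o ↔ A} ∩ {o ↔ b} ∩ {a ↮ b}` the trace `O = C_b ∩ A` is a nonempty subset of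
`A ∖ a`, and the configuration lies in `N'_O ∩ U_O ∩ B_O`; conversely.  [this file] -/
theorem pos_split (w : Sym2 (Fin n) → unitInterval) (A : Finset (Fin n)) (o b a : Fin n) (haA : a ∈ A) :
    (prodBernoulli w).real ((⋃ s ∈ A, (openConn o s : Set (BondConfig (Fin n)))) ∩ openConn o b ∩ (openConn a b)ᶜ) =
      ∑ O ∈ (A.erase a).powerset.filter (fun O => O.Nonempty),
        (prodBernoulli w).real
          ({ω : BondConfig (Fin n) | ∀ s ∈ insert o O, ∀ x ∈ A \ O, ¬ (openGraph ω).Reachable s x} ∩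
            ((⋃ s ∈ O, (openConn s o : Set (BondConfig (Fin n)))) ∩ ⋂ s ∈ O, (openConn s b : Set (BondConfig (Fin n))))) := by
  rw [← measureReal_biUnion_finset ?_ (fun _ _ => MeasurableSet.of_discrete)]
  · congr 1
    ext ω
    simp only [mem_inter_iff, mem_compl_iff, mem_iUnion, mem_iInter, exists_prop, mem_setOf_eq, openConn,
      Finset.mem_filter, Finset.mem_powerset]
    constructor
    · rintro ⟨⟨⟨s, hsA, hos⟩, hob⟩, hab⟩
      refine ⟨A.filter (fun x => (openGraph ω).Reachable b x), ⟨⟨?_, ⟨s, ?_⟩⟩, ?_, ⟨s, ?_, hos.symm⟩, ?_⟩⟩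
      · intro x hx
        rw [Finset.mem_filter] at hx
        rw [Finset.mem_erase]
        refine ⟨?_, hx.1⟩
        rintro rfl
        exact hab hx.2.symm
      · exact Finset.mem_filter.2 ⟨hsA, hob.symm.trans hos⟩
      · intro s' hs' x hx hsx
        rw [Finset.mem_sdiff, Finset.mem_filter] at hx
        rcases Finset.mem_insert.1 hs' with rfl | hs'O
        · exact hx.2 ⟨hx.1, hob.symm.trans hsx⟩
        · rw [Finset.mem_filter] at hs'O
          exact hx.2 ⟨hx.1, hs'O.2.trans hsx⟩
      · exact Finset.mem_filter.2 ⟨hsA, hob.symm.trans hos⟩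
      · intro x hx
        rw [Finset.mem_filter] at hx
        exact hx.2.symm
    · rintro ⟨O, ⟨hOsub, hOne⟩, hN, ⟨s, hsO, hso⟩, hB⟩
      have hsA : s ∈ A := (Finset.mem_erase.1 (hOsub hsO)).2
      have hsb : (openGraph ω).Reachable s b := hB s hsO
      refine ⟨⟨⟨s, hsA, hso.symm⟩, hso.symm.trans hsb⟩, fun hab => ?_⟩
      have haO : a ∉ O := fun h => (Finset.mem_erase.1 (hOsub h)).1 rfl
      exact hN s (Finset.mem_insert_of_mem hsO) a (Finset.mem_sdiff.2 ⟨haA, haO⟩) (hsb.trans hab.symm)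
  · intro O hO O' hO' hne
    rw [Function.onFun, Set.disjoint_left]
    rintro ω ⟨hN, ⟨hU, hB⟩⟩ ⟨hN', ⟨hU', hB'⟩⟩
    simp only [Finset.coe_filter, Finset.mem_powerset, mem_setOf_eq] at hO hO'
    simp only [mem_iUnion, mem_iInter, exists_prop, openConn, mem_setOf_eq] at hU hB hU' hB'
    apply hne  -- both `O` and `O'` equal the trace `{x ∈ A | b ↔ x}`
    have key : ∀ (P : Finset (Fin n)), P ⊆ A.erase a → P.Nonempty →
        (∀ s ∈ insert o P, ∀ x ∈ A \ P, ¬ (openGraph ω).Reachable s x) →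
        (∀ s ∈ P, (openGraph ω).Reachable s b) → ∀ x, x ∈ P ↔ (x ∈ A ∧ (openGraph ω).Reachable b x) := by
      intro P hPsub hPne hPN hPB x
      constructor
      · intro hx
        exact ⟨(Finset.mem_erase.1 (hPsub hx)).2, (hPB x hx).symm⟩
      · rintro ⟨hxA, hbx⟩
        by_contra hxP
        obtain ⟨s, hs⟩ := hPne
        exact hPN s (Finset.mem_insert_of_mem hs) x (Finset.mem_sdiff.2 ⟨hxA, hxP⟩) ((hPB s hs).trans hbx)
    ext x
    rw [key O hO.1 hO.2 hN hB x, key O' hO'.1 hO'.2 hN' hB' x]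


/-- Negative side of the k-relay split: on `{o ↔ A} ∩ {a ↔ b} ∩ {o ↮ b}` the set `O = A ∖ C_b` is a nonempty subset of
`A ∖ a` and the configuration lies in `N'_O ∩ U_O ∩ B_{A∖O}`; conversely.  [this file] -/
theorem neg_split (w : Sym2 (Fin n) → unitInterval) (A : Finset (Fin n)) (o b a : Fin n) (haA : a ∈ A) :
    (prodBernoulli w).real ((⋃ s ∈ A, (openConn o s : Set (BondConfig (Fin n)))) ∩ openConn a b ∩ (openConn o b)ᶜ) =
      ∑ O ∈ (A.erase a).powerset.filter (fun O => O.Nonempty),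
        (prodBernoulli w).real
          ({ω : BondConfig (Fin n) | ∀ s ∈ insert o O, ∀ x ∈ A \ O, ¬ (openGraph ω).Reachable s x} ∩
            ((⋃ s ∈ O, (openConn s o : Set (BondConfig (Fin n)))) ∩
              ⋂ s ∈ A \ O, (openConn s b : Set (BondConfig (Fin n))))) := by
  rw [← measureReal_biUnion_finset ?_ (fun _ _ => MeasurableSet.of_discrete)]
  · congr 1
    ext ω
    simp only [mem_inter_iff, mem_compl_iff, mem_iUnion, mem_iInter, exists_prop, mem_setOf_eq, openConn,
      Finset.mem_filter, Finset.mem_powerset]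
    constructor
    · rintro ⟨⟨⟨s, hsA, hos⟩, hab⟩, hob⟩
      have hbs : ¬ (openGraph ω).Reachable b s := fun h => hob (hos.trans h.symm)
      refine ⟨A.filter (fun x => ¬ (openGraph ω).Reachable b x), ⟨⟨?_, ⟨s, ?_⟩⟩, ?_, ⟨s, ?_, hos.symm⟩, ?_⟩⟩
      · intro x hx
        rw [Finset.mem_filter] at hx
        rw [Finset.mem_erase]
        refine ⟨?_, hx.1⟩
        rintro rfl
        exact hx.2 hab.symm
      · exact Finset.mem_filter.2 ⟨hsA, hbs⟩
      · intro s' hs' x hx hsx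
        rw [Finset.mem_sdiff, Finset.mem_filter] at hx
        have hbx : (openGraph ω).Reachable b x := by
          by_contra h
          exact hx.2 ⟨hx.1, h⟩
        rcases Finset.mem_insert.1 hs' with rfl | hs'O
        · exact hob (hsx.trans hbx.symm)
        · rw [Finset.mem_filter] at hs'O
          exact hs'O.2 (hbx.trans hsx.symm)
      · exact Finset.mem_filter.2 ⟨hsA, hbs⟩
      · intro x hx
        rw [Finset.mem_sdiff, Finset.mem_filter] at hx
        have hbx : (openGraph ω).Reachable b x := by
          by_contra h
          exact hx.2 ⟨hx.1, h⟩
        exact hbx.symm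
    · rintro ⟨O, ⟨hOsub, hOne⟩, hN, ⟨s, hsO, hso⟩, hB⟩
      have hsA : s ∈ A := (Finset.mem_erase.1 (hOsub hsO)).2
      have haO : a ∉ O := fun h => (Finset.mem_erase.1 (hOsub h)).1 rfl
      have hab : (openGraph ω).Reachable a b := hB a (Finset.mem_sdiff.2 ⟨haA, haO⟩)
      refine ⟨⟨⟨s, hsA, hso.symm⟩, hab⟩, fun hob => ?_⟩
      exact hN o (Finset.mem_insert_self o O) a (Finset.mem_sdiff.2 ⟨haA, haO⟩) (hob.trans hab.symm)
  · intro O hO O' hO' hne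
    rw [Function.onFun, Set.disjoint_left]
    rintro ω ⟨hN, ⟨hU, hB⟩⟩ ⟨hN', ⟨hU', hB'⟩⟩
    simp only [Finset.coe_filter, Finset.mem_powerset, mem_setOf_eq] at hO hO'
    simp only [mem_iUnion, mem_iInter, exists_prop, openConn, mem_setOf_eq] at hU hB hU' hB'
    apply hne  -- both `O` and `O'` equal `{x ∈ A | b ↮ x}`
    have key : ∀ (P : Finset (Fin n)), P ⊆ A.erase a →
        (∀ s ∈ insert o P, ∀ x ∈ A \ P, ¬ (openGraph ω).Reachable s x) →
        (∀ s ∈ A \ P, (openGraph ω).Reachable s b) → ∀ x, x ∈ P ↔ (x ∈ A ∧ ¬ (openGraph ω).Reachable b x) := by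
      intro P hPsub hPN hPB x
      have haP : a ∉ P := fun h => (Finset.mem_erase.1 (hPsub h)).1 rfl
      have hab : (openGraph ω).Reachable a b := hPB a (Finset.mem_sdiff.2 ⟨haA, haP⟩)
      constructor
      · intro hx
        refine ⟨(Finset.mem_erase.1 (hPsub hx)).2, fun hbx => ?_⟩
        exact hPN x (Finset.mem_insert_of_mem hx) a (Finset.mem_sdiff.2 ⟨haA, haP⟩) (hbx.symm.trans hab.symm)
      · rintro ⟨hxA, hbx⟩
        by_contra hxP
        exact hbx (hPB x (Finset.mem_sdiff.2 ⟨hxA, hxP⟩)).symm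
    ext x
    rw [key O hO.1 hN hB x, key O' hO'.1 hN' hB' x]

/-- `X = Σ_O (T_O − V_O)`: the refined Kozma–Nitzan split of `μ(o↔A, o↔b) − μ(o↔A, a↔b)` for any number of relays.
[cite: KozmaNitzan2024, Theorem 2 (§3.1, pp. 8–9) — the three-relay case] -/
theorem X_eq_sum (w : Sym2 (Fin n) → unitInterval) (A : Finset (Fin n)) (o b a : Fin n) (haA : a ∈ A) :
    (prodBernoulli w).real ((⋃ s ∈ A, (openConn o s : Set (BondConfig (Fin n)))) ∩ openConn o b) -
      (prodBernoulli w).real ((⋃ s ∈ A, (openConn o s : Set (BondConfig (Fin n)))) ∩ openConn a b) =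
      ∑ O ∈ (A.erase a).powerset.filter (fun O => O.Nonempty),
        ((prodBernoulli w).real
          ({ω : BondConfig (Fin n) | ∀ s ∈ insert o O, ∀ x ∈ A \ O, ¬ (openGraph ω).Reachable s x} ∩
            ((⋃ s ∈ O, (openConn s o : Set (BondConfig (Fin n)))) ∩ ⋂ s ∈ O, (openConn s b : Set (BondConfig (Fin n))))) -
         (prodBernoulli w).real
          ({ω : BondConfig (Fin n) | ∀ s ∈ insert o O, ∀ x ∈ A \ O, ¬ (openGraph ω).Reachable s x} ∩
            ((⋃ s ∈ O, (openConn s o : Set (BondConfig (Fin n)))) ∩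
              ⋂ s ∈ A \ O, (openConn s b : Set (BondConfig (Fin n)))))) := by
  rw [Finset.sum_sub_distrib, ← pos_split w A o b a haA, ← neg_split w A o b a haA]
  set E : Set (BondConfig (Fin n)) := ⋃ s ∈ A, (openConn o s : Set (BondConfig (Fin n))) with hE
  have hm : ∀ s : Set (BondConfig (Fin n)), MeasurableSet s := fun _ => MeasurableSet.of_discrete
  have h1 := measureReal_inter_add_sdiff (μ := prodBernoulli w) (s := E ∩ openConn o b) (hm (openConn a b))
  have h2 := measureReal_inter_add_sdiff (μ := prodBernoulli w) (s := E ∩ openConn a b) (hm (openConn o b))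
  have e1 : (E ∩ openConn o b) \ openConn a b = E ∩ openConn o b ∩ (openConn a b)ᶜ := by
    ext ω; simp only [mem_sdiff, mem_inter_iff, mem_compl_iff]
  have e2 : (E ∩ openConn a b) \ openConn o b = E ∩ openConn a b ∩ (openConn o b)ᶜ := by
    ext ω; simp only [mem_sdiff, mem_inter_iff, mem_compl_iff]
  have e3 : E ∩ openConn a b ∩ openConn o b = E ∩ openConn o b ∩ openConn a b := by
    rw [Set.inter_assoc, Set.inter_comm (openConn a b), ← Set.inter_assoc]
  rw [e1] at h1; rw [e2, e3] at h2
  linarith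

/-- Real arithmetic of one summand: from `A·m ≤ P·T`, `P·V ≤ A·m'`, `0 ≤ T` and `V ≤ P`:
`(A/P)·(m − m') ≤ T − V` (with `x/0 = 0`). [folklore] -/
theorem arith {P Aφ m m' T V : ℝ} (hV : V ≤ P) (hT0 : 0 ≤ T) (hP : 0 ≤ P)
    (i1 : Aφ * m ≤ P * T) (i2 : P * V ≤ Aφ * m') : Aφ / P * (m - m') ≤ T - V := by
  rcases eq_or_lt_of_le hP with hP0 | hPpos
  · rw [← hP0, div_zero, zero_mul]; linarith
  · rw [div_mul_eq_mul_div, div_le_iff₀ hPpos]; nlinarith [i1, i2]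

/-- Per-`O` BHK bound: with `P = μ(N'_O)`, `A = μ(N'_O ∩ U_O)`, `m = μ(N'_O ∩ B_O)`, `m' = μ(N'_O ∩ B_{A∖O})`,
`T = μ(N'_O ∩ U_O ∩ B_O)`, `V = μ(N'_O ∩ U_O ∩ B_{A∖O})`: `T − V ≥ (A/P)·(m − m')` (for `P = 0` both sides vanish).
Two instances of BHK 2006 (`stub_bhkSets` through `knRef_bhkOne`, `knRef_bhkTwo`) with source set `O ∪ {o}` against `A ∖ O`.
[cite: VandenbergHaggstromKahn2005, Thms. 1.3–1.4 (pp. 6–7)] -/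
theorem term_bound (w : Sym2 (Fin n) → unitInterval) (A O : Finset (Fin n)) (o b : Fin n)
    (ho : o ∉ A) :
    (prodBernoulli w).real
          ({ω : BondConfig (Fin n) | ∀ s ∈ insert o O, ∀ x ∈ A \ O, ¬ (openGraph ω).Reachable s x} ∩
            ⋃ s ∈ O, (openConn s o : Set (BondConfig (Fin n)))) /
        (prodBernoulli w).real
          {ω : BondConfig (Fin n) | ∀ s ∈ insert o O, ∀ x ∈ A \ O, ¬ (openGraph ω).Reachable s x} *
      ((prodBernoulli w).real
          ({ω : BondConfig (Fin n) | ∀ s ∈ insert o O, ∀ x ∈ A \ O, ¬ (openGraph ω).Reachable s x} ∩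
            ⋂ s ∈ O, (openConn s b : Set (BondConfig (Fin n)))) -
        (prodBernoulli w).real
          ({ω : BondConfig (Fin n) | ∀ s ∈ insert o O, ∀ x ∈ A \ O, ¬ (openGraph ω).Reachable s x} ∩
            ⋂ s ∈ A \ O, (openConn s b : Set (BondConfig (Fin n))))) ≤
    (prodBernoulli w).real
        ({ω : BondConfig (Fin n) | ∀ s ∈ insert o O, ∀ x ∈ A \ O, ¬ (openGraph ω).Reachable s x} ∩
          ((⋃ s ∈ O, (openConn s o : Set (BondConfig (Fin n)))) ∩ ⋂ s ∈ O, (openConn s b : Set (BondConfig (Fin n))))) -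
      (prodBernoulli w).real
        ({ω : BondConfig (Fin n) | ∀ s ∈ insert o O, ∀ x ∈ A \ O, ¬ (openGraph ω).Reachable s x} ∩
          ((⋃ s ∈ O, (openConn s o : Set (BondConfig (Fin n)))) ∩
            ⋂ s ∈ A \ O, (openConn s b : Set (BondConfig (Fin n))))) := by
  have hOS : O ⊆ insert o O := Finset.subset_insert o O
  have hSX : ∀ s ∈ insert o O, s ∉ (↑(A \ O) : Set (Fin n)) := by
    intro s hs hsX
    rw [Finset.mem_coe, Finset.mem_sdiff] at hsX
    rcases Finset.mem_insert.1 hs with rfl | hsO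
    · exact ho hsX.1
    · exact hsX.2 hsO
  have hdisj : Disjoint (insert o O) (A \ O) := by
    rw [Finset.disjoint_left]
    intro s hs hsX
    rw [Finset.mem_sdiff] at hsX
    rcases Finset.mem_insert.1 hs with rfl | hsO
    · exact ho hsX.1
    · exact hsX.2 hsO
  have i1 := knRef_bhkOne stub_bhkSets.1 w (insert o O) O hOS (↑(A \ O) : Set (Fin n)) o b hSX
  have i2 := knRef_bhkTwo stub_bhkSets.2 w (insert o O) (A \ O) O (A \ O) hOS subset_rfl o b hdisj
  have hset : {ω : BondConfig (Fin n) | ∀ s ∈ insert o O, ∀ x ∈ (↑(A \ O) : Set (Fin n)),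
      ¬ (openGraph ω).Reachable s x} =
      {ω : BondConfig (Fin n) | ∀ s ∈ insert o O, ∀ x ∈ A \ O, ¬ (openGraph ω).Reachable s x} := by
    ext ω; simp only [mem_setOf_eq, Finset.mem_coe]
  rw [hset] at i1
  exact arith (measureReal_mono Set.inter_subset_left) measureReal_nonneg measureReal_nonneg i1 i2

/-- **Event gluing at a designated relay from the refined residual row (any number of relays).**  If `a ∈ A`, `o ∉ A` and
`0 ≤ μ(o↮A, a↮b) + Σ_{∅≠O⊆A∖a} φ'_O (m'_O − m'_{A∖O})` (conditional form, `x/0 = 0`), then `μ({o↔A} ∖ {o↔b}) ≤ μ(a ↮ b)`.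
[this file] -/
theorem eg_of_refinedResidual_at (w : Sym2 (Fin n) → unitInterval) (A : Finset (Fin n)) (o b a : Fin n)
    (haA : a ∈ A) (ho : o ∉ A)
    (hres : 0 ≤ (prodBernoulli w).real ((⋃ s ∈ A, (openConn o s : Set (BondConfig (Fin n))))ᶜ ∩ (openConn a b)ᶜ) +
      ∑ O ∈ (A.erase a).powerset.filter (fun O => O.Nonempty),
        (prodBernoulli w).real ({ω : BondConfig (Fin n) | ∀ s ∈ insert o O, ∀ x ∈ A \ O, ¬ (openGraph ω).Reachable s x} ∩
              ⋃ s ∈ O, (openConn s o : Set (BondConfig (Fin n)))) /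
          (prodBernoulli w).real {ω : BondConfig (Fin n) | ∀ s ∈ insert o O, ∀ x ∈ A \ O, ¬ (openGraph ω).Reachable s x} *
        ((prodBernoulli w).real ({ω : BondConfig (Fin n) | ∀ s ∈ insert o O, ∀ x ∈ A \ O, ¬ (openGraph ω).Reachable s x} ∩
              ⋂ s ∈ O, (openConn s b : Set (BondConfig (Fin n)))) -
          (prodBernoulli w).real ({ω : BondConfig (Fin n) | ∀ s ∈ insert o O, ∀ x ∈ A \ O, ¬ (openGraph ω).Reachable s x} ∩
              ⋂ s ∈ A \ O, (openConn s b : Set (BondConfig (Fin n)))))) :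
    (prodBernoulli w).real ((⋃ s ∈ A, (openConn o s : Set (BondConfig (Fin n)))) \ openConn o b) ≤
      (prodBernoulli w).real ((openConn a b)ᶜ : Set (BondConfig (Fin n))) := by
  have hX := X_eq_sum w A o b a haA
  have hsum : ∑ O ∈ (A.erase a).powerset.filter (fun O => O.Nonempty),
        (prodBernoulli w).real ({ω : BondConfig (Fin n) | ∀ s ∈ insert o O, ∀ x ∈ A \ O, ¬ (openGraph ω).Reachable s x} ∩
              ⋃ s ∈ O, (openConn s o : Set (BondConfig (Fin n)))) /
          (prodBernoulli w).real {ω : BondConfig (Fin n) | ∀ s ∈ insert o O, ∀ x ∈ A \ O, ¬ (openGraph ω).Reachable s x} *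
        ((prodBernoulli w).real ({ω : BondConfig (Fin n) | ∀ s ∈ insert o O, ∀ x ∈ A \ O, ¬ (openGraph ω).Reachable s x} ∩
              ⋂ s ∈ O, (openConn s b : Set (BondConfig (Fin n)))) -
          (prodBernoulli w).real ({ω : BondConfig (Fin n) | ∀ s ∈ insert o O, ∀ x ∈ A \ O, ¬ (openGraph ω).Reachable s x} ∩
              ⋂ s ∈ A \ O, (openConn s b : Set (BondConfig (Fin n))))) ≤
      ∑ O ∈ (A.erase a).powerset.filter (fun O => O.Nonempty),
        ((prodBernoulli w).real
          ({ω : BondConfig (Fin n) | ∀ s ∈ insert o O, ∀ x ∈ A \ O, ¬ (openGraph ω).Reachable s x} ∩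
            ((⋃ s ∈ O, (openConn s o : Set (BondConfig (Fin n)))) ∩ ⋂ s ∈ O, (openConn s b : Set (BondConfig (Fin n))))) -
         (prodBernoulli w).real
          ({ω : BondConfig (Fin n) | ∀ s ∈ insert o O, ∀ x ∈ A \ O, ¬ (openGraph ω).Reachable s x} ∩
            ((⋃ s ∈ O, (openConn s o : Set (BondConfig (Fin n)))) ∩
              ⋂ s ∈ A \ O, (openConn s b : Set (BondConfig (Fin n)))))) := by
    exact Finset.sum_le_sum fun O _ => term_bound w A O o b ho
  -- bookkeeping `μ(E ∩ ab) ≤ μ(E ∩ ob) + μ(Eᶜ ∩ abᶜ) ⇒ μ(E ∖ ob) ≤ μ(abᶜ)` (as `EG3Residual.eg3_of_XZ`)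
  set E : Set (BondConfig (Fin n)) := ⋃ s ∈ A, (openConn o s : Set (BondConfig (Fin n))) with hE
  have hm : ∀ s : Set (BondConfig (Fin n)), MeasurableSet s := fun _ => MeasurableSet.of_discrete
  have h1 := measureReal_inter_add_sdiff (μ := prodBernoulli w) (s := E) (hm (openConn o b)) (h := measure_ne_top _ _)
  have h3 := measureReal_inter_add_sdiff (μ := prodBernoulli w) (s := ((openConn a b)ᶜ : Set (BondConfig (Fin n))))
    (hm E)
  have e1 : ((openConn a b)ᶜ : Set (BondConfig (Fin n))) ∩ E = E \ openConn a b := by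
    ext ω; simp only [mem_inter_iff, mem_compl_iff, mem_sdiff]; tauto
  have e2 : ((openConn a b)ᶜ : Set (BondConfig (Fin n))) \ E = Eᶜ ∩ (openConn a b)ᶜ := by
    ext ω; simp only [mem_inter_iff, mem_compl_iff, mem_sdiff]; tauto
  have h2 := measureReal_inter_add_sdiff (μ := prodBernoulli w) (s := E) (hm (openConn a b)) (h := measure_ne_top _ _)
  rw [e1, e2] at h3
  linarith

end EventGluingRefinedK

open EventGluingRefinedK

/-- **Refined residual row (all `k`) ⇒ event gluing (all relay sets).**  Hypothesis `REF`: for every finite weighted graph,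
observer `o ∉ A`, sink `b` and WORST relay `a ∈ A` (`μ(x ↮ b) ≤ μ(a ↮ b)` on `A`),
`0 ≤ μ(o↮A, a↮b) + Σ_{∅≠O⊆A∖a} φ'_O · (m'_O − m'_{A∖O})` (conditional form; `N'_O = {O ∪ {o} ↮ A ∖ O}`,
`φ'_O = μ(N'_O ∩ {o ↔ O})/μ(N'_O)`, `m'_T = μ(N'_O ∩ {b ↔ all of T})`).  Conclusion: `μ({o ↮ c} ∩ ⋃_{a∈A}{o ↔ a}) ≤ s`
whenever `μ(a ↮ c) ≤ s` on `A`. [this file] -/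
theorem eventGluing_of_refinedResidual
    (hREF : ∀ (n : ℕ) (w : Sym2 (Fin n) → unitInterval) (A : Finset (Fin n)) (o b a : Fin n),
      a ∈ A → o ∉ A →
      (∀ x ∈ A, (prodBernoulli w).real (openConn x b : Set (BondConfig (Fin n)))ᶜ ≤
        (prodBernoulli w).real (openConn a b : Set (BondConfig (Fin n)))ᶜ) →
      0 ≤ (prodBernoulli w).real ((⋃ s ∈ A, (openConn o s : Set (BondConfig (Fin n))))ᶜ ∩ (openConn a b)ᶜ) +
        ∑ O ∈ (A.erase a).powerset.filter (fun O => O.Nonempty),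
          (prodBernoulli w).real ({ω : BondConfig (Fin n) | ∀ s ∈ insert o O, ∀ x ∈ A \ O, ¬ (openGraph ω).Reachable s x} ∩
              ⋃ s ∈ O, (openConn s o : Set (BondConfig (Fin n)))) /
            (prodBernoulli w).real {ω : BondConfig (Fin n) | ∀ s ∈ insert o O, ∀ x ∈ A \ O, ¬ (openGraph ω).Reachable s x} *
          ((prodBernoulli w).real ({ω : BondConfig (Fin n) | ∀ s ∈ insert o O, ∀ x ∈ A \ O, ¬ (openGraph ω).Reachable s x} ∩
              ⋂ s ∈ O, (openConn s b : Set (BondConfig (Fin n)))) -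
            (prodBernoulli w).real ({ω : BondConfig (Fin n) | ∀ s ∈ insert o O, ∀ x ∈ A \ O, ¬ (openGraph ω).Reachable s x} ∩
              ⋂ s ∈ A \ O, (openConn s b : Set (BondConfig (Fin n)))))) :
    ∀ (n : ℕ) (w : Sym2 (Fin n) → unitInterval) (A : Finset (Fin n)) (o c : Fin n) (s : ℝ), 0 ≤ s →
      (∀ a ∈ A, (prodBernoulli w).real (openConn a c : Set (BondConfig (Fin n)))ᶜ ≤ s) →
      (prodBernoulli w).real ((openConn o c : Set (BondConfig (Fin n)))ᶜ ∩ ⋃ a ∈ A, openConn o a) ≤ s := by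
  intro n w A o c s hs hcut
  have hset : (openConn o c : Set (BondConfig (Fin n)))ᶜ ∩ (⋃ a ∈ A, (openConn o a : Set (BondConfig (Fin n)))) =
      (⋃ a ∈ A, (openConn o a : Set (BondConfig (Fin n)))) \ openConn o c := by
    ext ω; simp only [mem_inter_iff, mem_compl_iff, mem_sdiff]; tauto
  rw [hset]
  rcases A.eq_empty_or_nonempty with hA | hA
  · subst hA
    simpa using hs
  · by_cases hoA : o ∈ A
    · calc (prodBernoulli w).real ((⋃ a ∈ A, (openConn o a : Set (BondConfig (Fin n)))) \ openConn o c)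
          ≤ (prodBernoulli w).real ((openConn o c : Set (BondConfig (Fin n)))ᶜ) :=
            measureReal_mono (fun ω hω => hω.2)
        _ ≤ s := hcut o hoA
    · obtain ⟨a, haA, hmax⟩ := Finset.exists_max_image A
        (fun x => (prodBernoulli w).real (openConn x c : Set (BondConfig (Fin n)))ᶜ) hA
      have key := eg_of_refinedResidual_at w A o c a haA hoA (hREF n w A o c a haA hoA hmax)
      exact key.trans (hcut a haA)

/-- **Refined residual row (all `k`) ⇒ `AdditiveGluing`** (stmt-CriticalPhenomena-4576). [this file] -/
theorem additiveGluing_of_refinedResidual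
    (hREF : ∀ (n : ℕ) (w : Sym2 (Fin n) → unitInterval) (A : Finset (Fin n)) (o b a : Fin n),
      a ∈ A → o ∉ A →
      (∀ x ∈ A, (prodBernoulli w).real (openConn x b : Set (BondConfig (Fin n)))ᶜ ≤
        (prodBernoulli w).real (openConn a b : Set (BondConfig (Fin n)))ᶜ) →
      0 ≤ (prodBernoulli w).real ((⋃ s ∈ A, (openConn o s : Set (BondConfig (Fin n))))ᶜ ∩ (openConn a b)ᶜ) +
        ∑ O ∈ (A.erase a).powerset.filter (fun O => O.Nonempty),
          (prodBernoulli w).real ({ω : BondConfig (Fin n) | ∀ s ∈ insert o O, ∀ x ∈ A \ O, ¬ (openGraph ω).Reachable s x} ∩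
              ⋃ s ∈ O, (openConn s o : Set (BondConfig (Fin n)))) /
            (prodBernoulli w).real {ω : BondConfig (Fin n) | ∀ s ∈ insert o O, ∀ x ∈ A \ O, ¬ (openGraph ω).Reachable s x} *
          ((prodBernoulli w).real ({ω : BondConfig (Fin n) | ∀ s ∈ insert o O, ∀ x ∈ A \ O, ¬ (openGraph ω).Reachable s x} ∩
              ⋂ s ∈ O, (openConn s b : Set (BondConfig (Fin n)))) -
            (prodBernoulli w).real ({ω : BondConfig (Fin n) | ∀ s ∈ insert o O, ∀ x ∈ A \ O, ¬ (openGraph ω).Reachable s x} ∩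
              ⋂ s ∈ A \ O, (openConn s b : Set (BondConfig (Fin n)))))) :
    Summit.CriticalPhenomena.PercolationContinuityZ3.Theses.PercNearOneGluing.AdditiveGluing :=
  additiveGluing_of_eventGluing (eventGluing_of_refinedResidual hREF)

/-- **Refined residual row (all `k`) ⇒ `NoHeavyLowerTail`** (stmt-CriticalPhenomena-4575): the k-uniform refined residual
conjecture `REF_k` (worst relay) is a sufficient condition for the crux, through event gluing ⇒ `AdditiveGluing` ⇒
`NearOneGluing` ⇒ `NoHeavyLowerTail` (landed glue). [this file] -/
theorem noHeavyLowerTail_of_refinedResidual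
    (hREF : ∀ (n : ℕ) (w : Sym2 (Fin n) → unitInterval) (A : Finset (Fin n)) (o b a : Fin n),
      a ∈ A → o ∉ A →
      (∀ x ∈ A, (prodBernoulli w).real (openConn x b : Set (BondConfig (Fin n)))ᶜ ≤
        (prodBernoulli w).real (openConn a b : Set (BondConfig (Fin n)))ᶜ) →
      0 ≤ (prodBernoulli w).real ((⋃ s ∈ A, (openConn o s : Set (BondConfig (Fin n))))ᶜ ∩ (openConn a b)ᶜ) +
        ∑ O ∈ (A.erase a).powerset.filter (fun O => O.Nonempty),
          (prodBernoulli w).real ({ω : BondConfig (Fin n) | ∀ s ∈ insert o O, ∀ x ∈ A \ O, ¬ (openGraph ω).Reachable s x} ∩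
              ⋃ s ∈ O, (openConn s o : Set (BondConfig (Fin n)))) /
            (prodBernoulli w).real {ω : BondConfig (Fin n) | ∀ s ∈ insert o O, ∀ x ∈ A \ O, ¬ (openGraph ω).Reachable s x} *
          ((prodBernoulli w).real ({ω : BondConfig (Fin n) | ∀ s ∈ insert o O, ∀ x ∈ A \ O, ¬ (openGraph ω).Reachable s x} ∩
              ⋂ s ∈ O, (openConn s b : Set (BondConfig (Fin n)))) -
            (prodBernoulli w).real ({ω : BondConfig (Fin n) | ∀ s ∈ insert o O, ∀ x ∈ A \ O, ¬ (openGraph ω).Reachable s x} ∩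
              ⋂ s ∈ A \ O, (openConn s b : Set (BondConfig (Fin n)))))) :
    Summit.CriticalPhenomena.PercolationContinuityZ3.Theses.PercNearOneGluing.NoHeavyLowerTail :=
  noHeavyLowerTail_of_eventGluing (eventGluing_of_refinedResidual hREF)

end

end Summit.CriticalPhenomena.PercolationContinuityZ3.Theorems
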